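import Summits.Ventures.PercRepro.RankLevelSetLevelSixHeavyCellSq27DI
import Summits.Ventures.PercRepro.RankLevelSetLevelSixCapGlue25
import Summits.Ventures.PercRepro.TriangleCapEightI
import Summits.Ventures.PercRepro.S1TrianglePlusSharp
import Summits.Ventures.PercRepro.S1SeriesLever14
import Summits.Ventures.PercRepro.RankLevelSetLevelSixArithHeavySq25DNA
import Summits.Ventures.PercRepro.RankLevelSetLevelSixArithHeavySq25DNB
import Summits.Ventures.PercRepro.RankLevelSetLevelSixArithHeavySq25DNC
import Summits.Ventures.PercRepro.RankLevelSetLevelSixArithHeavySq25DND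
import Summits.Ventures.PercRepro.RankLevelSetLevelSixArithHeavySq25DNE
import Summits.Ventures.PercRepro.RankLevelSetLevelSixArithHeavySq25DNF
import Summits.Ventures.PercRepro.RankLevelSetLevelSixArithHeavySq25DNG
import Summits.Ventures.PercRepro.RankLevelSetLevelSixArithHeavySq25DNH
import Summits.Ventures.PercRepro.RankLevelSetLevelSixArithHeavySq25DNI

/-!
# PercRepro — THE 25 ROW, THE CELLS `(p ≥ 25, 15 ≤ d ≤ 31)`, `d ≠ 24`, EVERY CORE (p8 g9, S3)

`proofs/SUBCLAIM-S3-p8.md` §3w (THE 25 ROW). Axioms: standard.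
-/

open scoped Matroid

namespace PercRepro

namespace ThmN

open Set

variable {α : Type}

/-- **The `e`-free core at level `6`, corank `15 ≤ d ≤ 31`, `d ≠ 24`, rank `p ≥ 25`, EVERY core** (the corrected cell with the per-corank parameters of ArithHeavySq25DNA … I and the NULLITY-ONLY caps: p3's `cq3` table, `avgChain14 d`, `avgChain5c d`). -/
theorem c025_core_six_bounded_corank_heavy_sq25_mid (M : Matroid α) [M.Finite] (p d : ℕ) (hp : 25 ≤ p) (hd15 : 15 ≤ d) (hd31 : d ≤ 31) (h24 : d ≠ 24)
    (hR : M.eRank = (p : ℕ∞)) (hn : M.E.ncard = p + d)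
    (hfree : ∀ e ∈ M.E, ∃ A ⊆ M.E \ {e}, e ∉ M.closure A ∧ e ∉ M.closure ((M.E \ {e}) \ A)) :
    RLS M p 6 := by
  have hd : M.E.encard = M.eRank + d := by
    rw [hR, ← M.ground_finite.cast_ncard_eq, hn]
    push_cast
    ring
  have hL : ∀ e ∈ M.E, ¬ M.IsLoop e := not_isLoop_of_free M hfree
  have hs : ∀ e ∈ M.E, ∀ f ∈ M.E, e ≠ f → M.eRk {e, f} = 2 := by
    intro e he f hf hef
    have h2 : (2 : ℕ∞) ≤ M.eRk {e, f} :=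
      two_le_eRk_of_two_le_ncard_of_free M hfree (pair_subset he hf) (by rw [ncard_pair hef])
    have h3 : M.eRk {e, f} ≤ 2 := by
      have := M.eRk_le_encard {e, f}
      rwa [encard_pair hef] at this
    exact le_antisymm h3 h2
  have hC1 : ∀ L ⊆ M.E, M.eRk L = 2 → L.ncard ≤ 3 :=
    fun L hL hr => ncard_le_three_of_eRk_two M hs hfree hL hr
  have hC2 : ∀ P ⊆ M.E, M.eRk P ≤ 3 → P.ncard ≤ 6 :=
    fun P hP hr => ncard_le_six_of_eRk_le_three_of_free M hfree hP hr
  have hΦ : phiK p 6 ≤ (2 : ℚ) ^ (p + 6) / (((p + 6).choose 6 : ℕ) : ℚ) := phiK_le_two_pow_div_six p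
  rw [RLS_iff]
  interval_cases d
  · exact c025_core_six_heavy_cell_sq27di M p 15 11 1 1 25 19 0 12943 1000 21 7044 588 47
      ((p + 6).choose 6) (Nat.choose_pos (by omega)) (phiK p 6) hΦ (by norm_num) (by omega)
      (by norm_num) (by norm_num) (by norm_num) (by norm_num) (by norm_num)
      (by norm_num [cnull]) (by norm_num [cnull]) (Or.inl (by norm_num)) (Or.inr (Or.inl ⟨by norm_num, by norm_num⟩)) (Or.inl (by norm_num)) (by norm_num) (by norm_num) (by norm_num)
      ((TriangleCap.core_ncard_triangles_le_cq3 M hfree hd).trans (by decide))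
      ((ncard_fourCircuits_le_avgChain14 15 M hfree hd).trans (by decide))
      ((S1.ncard_fiveCircuits_le_avgChain5c 15 M hfree hd).trans (by decide))
      (Or.inl (tail_six_heavy_sq25DN_15 p hp)) hR hn hfree (level_six_poly_heavy_sq25DN_15 p hp)
  · exact c025_core_six_heavy_cell_sq27di M p 16 12 1 1 26 19 0 9453 1000 22 9245 726 54
      ((p + 6).choose 6) (Nat.choose_pos (by omega)) (phiK p 6) hΦ (by norm_num) (by omega)
      (by norm_num) (by norm_num) (by norm_num) (by norm_num) (by norm_num)
      (by norm_num [cnull]) (by norm_num [cnull]) (Or.inl (by norm_num)) (Or.inr (Or.inl ⟨by norm_num, by norm_num⟩)) (Or.inl (by norm_num)) (by norm_num) (by norm_num) (by norm_num)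
      ((TriangleCap.core_ncard_triangles_le_cq3 M hfree hd).trans (by decide))
      ((ncard_fourCircuits_le_avgChain14 16 M hfree hd).trans (by decide))
      ((S1.ncard_fiveCircuits_le_avgChain5c 16 M hfree hd).trans (by decide))
      (Or.inl (tail_six_heavy_sq25DN_16 p hp)) hR hn hfree (level_six_poly_heavy_sq25DN_16 p hp)
  · exact c025_core_six_heavy_cell_sq27di M p 17 12 1 1 28 19 0 7132 1000 23 11964 887 62
      ((p + 6).choose 6) (Nat.choose_pos (by omega)) (phiK p 6) hΦ (by norm_num) (by omega)
      (by norm_num) (by norm_num) (by norm_num) (by norm_num) (by norm_num)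
      (by norm_num [cnull]) (by norm_num [cnull]) (Or.inl (by norm_num)) (Or.inr (Or.inl ⟨by norm_num, by norm_num⟩)) (Or.inl (by norm_num)) (by norm_num) (by norm_num) (by norm_num)
      ((TriangleCap.core_ncard_triangles_le_cq3 M hfree hd).trans (by decide))
      ((ncard_fourCircuits_le_avgChain14 17 M hfree hd).trans (by decide))
      ((S1.ncard_fiveCircuits_le_avgChain5c 17 M hfree hd).trans (by decide))
      (Or.inl (tail_six_heavy_sq25DN_17 p hp)) hR hn hfree (level_six_poly_heavy_sq25DN_17 p hp)
  · exact c025_core_six_heavy_cell_sq27di M p 18 13 1 1 29 19 0 5543 1000 24 15287 1073 71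
      ((p + 6).choose 6) (Nat.choose_pos (by omega)) (phiK p 6) hΦ (by norm_num) (by omega)
      (by norm_num) (by norm_num) (by norm_num) (by norm_num) (by norm_num)
      (by norm_num [cnull]) (by norm_num [cnull]) (Or.inl (by norm_num)) (Or.inr (Or.inl ⟨by norm_num, by norm_num⟩)) (Or.inl (by norm_num)) (by norm_num) (by norm_num) (by norm_num)
      ((TriangleCap.core_ncard_triangles_le_cq3 M hfree hd).trans (by decide))
      ((ncard_fourCircuits_le_avgChain14 18 M hfree hd).trans (by decide))
      ((S1.ncard_fiveCircuits_le_avgChain5c 18 M hfree hd).trans (by decide))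
      (Or.inl (tail_six_heavy_sq25DN_18 p hp)) hR hn hfree (level_six_poly_heavy_sq25DN_18 p hp)
  · exact c025_core_six_heavy_cell_sq27di M p 19 13 1 1 31 19 0 4426 1000 25 19309 1287 81
      ((p + 6).choose 6) (Nat.choose_pos (by omega)) (phiK p 6) hΦ (by norm_num) (by omega)
      (by norm_num) (by norm_num) (by norm_num) (by norm_num) (by norm_num)
      (by norm_num [cnull]) (by norm_num [cnull]) (Or.inl (by norm_num)) (Or.inr (Or.inl ⟨by norm_num, by norm_num⟩)) (Or.inl (by norm_num)) (by norm_num) (by norm_num) (by norm_num)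
      ((TriangleCap.core_ncard_triangles_le_cq3 M hfree hd).trans (by decide))
      ((ncard_fourCircuits_le_avgChain14 19 M hfree hd).trans (by decide))
      ((S1.ncard_fiveCircuits_le_avgChain5c 19 M hfree hd).trans (by decide))
      (Or.inl (tail_six_heavy_sq25DN_19 p hp)) hR hn hfree (level_six_poly_heavy_sq25DN_19 p hp)
  · exact c025_core_six_heavy_cell_sq27di M p 20 14 1 1 32 19 0 3623 1000 26 24136 1532 92
      ((p + 6).choose 6) (Nat.choose_pos (by omega)) (phiK p 6) hΦ (by norm_num) (by omega)
      (by norm_num) (by norm_num) (by norm_num) (by norm_num) (by norm_num)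
      (by norm_num [cnull]) (by norm_num [cnull]) (Or.inl (by norm_num)) (Or.inr (Or.inl ⟨by norm_num, by norm_num⟩)) (Or.inl (by norm_num)) (by norm_num) (by norm_num) (by norm_num)
      ((TriangleCap.core_ncard_triangles_le_cq3 M hfree hd).trans (by decide))
      ((ncard_fourCircuits_le_avgChain14 20 M hfree hd).trans (by decide))
      ((S1.ncard_fiveCircuits_le_avgChain5c 20 M hfree hd).trans (by decide))
      (Or.inl (tail_six_heavy_sq25DN_20 p hp)) hR hn hfree (level_six_poly_heavy_sq25DN_20 p hp)
  · exact c025_core_six_heavy_cell_sq27di M p 21 15 1 1 33 0 0 3034 1000 27 29882 1810 104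
      ((p + 6).choose 6) (Nat.choose_pos (by omega)) (phiK p 6) hΦ (by norm_num) (by omega)
      (by norm_num) (by norm_num) (by norm_num) (by norm_num) (by norm_num)
      (by norm_num [cnull]) (by norm_num [cnull]) (Or.inl (by norm_num)) (Or.inr (Or.inr (by norm_num))) (Or.inl (by norm_num)) (by norm_num) (by norm_num) (by norm_num)
      ((TriangleCap.core_ncard_triangles_le_cq3 M hfree hd).trans (by decide))
      ((ncard_fourCircuits_le_avgChain14 21 M hfree hd).trans (by decide))
      ((S1.ncard_fiveCircuits_le_avgChain5c 21 M hfree hd).trans (by decide))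
      (Or.inl (tail_six_heavy_sq25DN_21 p hp)) hR hn hfree (level_six_poly_heavy_sq25DN_21 p hp)
  · exact c025_core_six_heavy_cell_sq27di M p 22 17 1 1 33 0 1 2593 1000 28 36673 2124 117
      ((p + 6).choose 6) (Nat.choose_pos (by omega)) (phiK p 6) hΦ (by norm_num) (by omega)
      (by norm_num) (by norm_num) (by norm_num) (by norm_num) (by norm_num)
      (by norm_num [cnull]) (by norm_num [cnull]) (Or.inl (by norm_num)) (Or.inr (Or.inr (by norm_num))) (Or.inr rfl) (by norm_num) (by norm_num) (by norm_num)
      ((TriangleCap.core_ncard_triangles_le_cq3 M hfree hd).trans (by decide))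
      ((ncard_fourCircuits_le_avgChain14 22 M hfree hd).trans (by decide))
      ((S1.ncard_fiveCircuits_le_avgChain5c 22 M hfree hd).trans (by decide))
      (Or.inl (tail_six_heavy_sq25DN_22 p hp)) hR hn hfree (level_six_poly_heavy_sq25DN_22 p hp)
  · exact c025_core_six_heavy_cell_sq27di M p 23 18 1 1 34 0 1 2257 1000 29 44645 2478 131
      ((p + 6).choose 6) (Nat.choose_pos (by omega)) (phiK p 6) hΦ (by norm_num) (by omega)
      (by norm_num) (by norm_num) (by norm_num) (by norm_num) (by norm_num)
      (by norm_num [cnull]) (by norm_num [cnull]) (Or.inl (by norm_num)) (Or.inr (Or.inr (by norm_num))) (Or.inr rfl) (by norm_num) (by norm_num) (by norm_num)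
      ((TriangleCap.core_ncard_triangles_le_cq3 M hfree hd).trans (by decide))
      ((ncard_fourCircuits_le_avgChain14 23 M hfree hd).trans (by decide))
      ((S1.ncard_fiveCircuits_le_avgChain5c 23 M hfree hd).trans (by decide))
      (Or.inl (tail_six_heavy_sq25DN_23 p hp)) hR hn hfree (level_six_poly_heavy_sq25DN_23 p hp)
  · exact absurd rfl h24
  · exact c025_core_six_heavy_cell_sq27di M p 25 20 1 1 31 0 1 1797 1000 31 64735 3316 162
      ((p + 6).choose 6) (Nat.choose_pos (by omega)) (phiK p 6) hΦ (by norm_num) (by omega)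
      (by norm_num) (by norm_num) (by norm_num) (by norm_num) (by norm_num)
      (by norm_num [cnull]) (by norm_num [cnull]) (Or.inr ⟨by norm_num, by norm_num⟩) (Or.inr (Or.inr (by norm_num))) (Or.inr rfl) (by norm_num) (by norm_num) (by norm_num)
      ((TriangleCap.core_ncard_triangles_le_cq3 M hfree hd).trans (by decide))
      ((ncard_fourCircuits_le_avgChain14 25 M hfree hd).trans (by decide))
      ((S1.ncard_fiveCircuits_le_avgChain5c 25 M hfree hd).trans (by decide))
      (Or.inl (tail_six_heavy_sq25DN_25 p hp)) hR hn hfree (level_six_poly_heavy_sq25DN_25 p hp)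
  · exact c025_core_six_heavy_cell_sq27di M p 26 21 1 1 32 0 1 1638 1000 32 77184 3807 179
      ((p + 6).choose 6) (Nat.choose_pos (by omega)) (phiK p 6) hΦ (by norm_num) (by omega)
      (by norm_num) (by norm_num) (by norm_num) (by norm_num) (by norm_num)
      (by norm_num [cnull]) (by norm_num [cnull]) (Or.inr ⟨by norm_num, by norm_num⟩) (Or.inr (Or.inr (by norm_num))) (Or.inr rfl) (by norm_num) (by norm_num) (by norm_num)
      ((TriangleCap.core_ncard_triangles_le_cq3 M hfree hd).trans (by decide))
      ((ncard_fourCircuits_le_avgChain14 26 M hfree hd).trans (by decide))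
      ((S1.ncard_fiveCircuits_le_avgChain5c 26 M hfree hd).trans (by decide))
      (Or.inl (tail_six_heavy_sq25DN_26 p hp)) hR hn hfree (level_six_poly_heavy_sq25DN_26 p hp)
  · exact c025_core_six_heavy_cell_sq27di M p 27 21 1 1 33 0 1 1512 1000 33 91477 4350 197
      ((p + 6).choose 6) (Nat.choose_pos (by omega)) (phiK p 6) hΦ (by norm_num) (by omega)
      (by norm_num) (by norm_num) (by norm_num) (by norm_num) (by norm_num)
      (by norm_num [cnull]) (by norm_num [cnull]) (Or.inr ⟨by norm_num, by norm_num⟩) (Or.inr (Or.inr (by norm_num))) (Or.inr rfl) (by norm_num) (by norm_num) (by norm_num)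
      ((TriangleCap.core_ncard_triangles_le_cq3 M hfree hd).trans (by decide))
      ((ncard_fourCircuits_le_avgChain14 27 M hfree hd).trans (by decide))
      ((S1.ncard_fiveCircuits_le_avgChain5c 27 M hfree hd).trans (by decide))
      (Or.inl (tail_six_heavy_sq25DN_27 p hp)) hR hn hfree (level_six_poly_heavy_sq25DN_27 p hp)
  · exact c025_core_six_heavy_cell_sq27di M p 28 22 1 1 34 0 1 1411 1000 34 107812 4950 216
      ((p + 6).choose 6) (Nat.choose_pos (by omega)) (phiK p 6) hΦ (by norm_num) (by omega)
      (by norm_num) (by norm_num) (by norm_num) (by norm_num) (by norm_num)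
      (by norm_num [cnull]) (by norm_num [cnull]) (Or.inr ⟨by norm_num, by norm_num⟩) (Or.inr (Or.inr (by norm_num))) (Or.inr rfl) (by norm_num) (by norm_num) (by norm_num)
      ((TriangleCap.core_ncard_triangles_le_cq3 M hfree hd).trans (by decide))
      ((ncard_fourCircuits_le_avgChain14 28 M hfree hd).trans (by decide))
      ((S1.ncard_fiveCircuits_le_avgChain5c 28 M hfree hd).trans (by decide))
      (Or.inl (tail_six_heavy_sq25DN_28 p hp)) hR hn hfree (level_six_poly_heavy_sq25DN_28 p hp)
  · exact c025_core_six_heavy_cell_sq27di M p 29 22 1 1 35 0 1 1330 1000 35 126400 5610 236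
      ((p + 6).choose 6) (Nat.choose_pos (by omega)) (phiK p 6) hΦ (by norm_num) (by omega)
      (by norm_num) (by norm_num) (by norm_num) (by norm_num) (by norm_num)
      (by norm_num [cnull]) (by norm_num [cnull]) (Or.inr ⟨by norm_num, by norm_num⟩) (Or.inr (Or.inr (by norm_num))) (Or.inr rfl) (by norm_num) (by norm_num) (by norm_num)
      ((TriangleCap.core_ncard_triangles_le_cq3 M hfree hd).trans (by decide))
      ((ncard_fourCircuits_le_avgChain14 29 M hfree hd).trans (by decide))
      ((S1.ncard_fiveCircuits_le_avgChain5c 29 M hfree hd).trans (by decide))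
      (Or.inl (tail_six_heavy_sq25DN_29 p hp)) hR hn hfree (level_six_poly_heavy_sq25DN_29 p hp)
  · exact c025_core_six_heavy_cell_sq27di M p 30 23 1 1 36 0 1 1264 1000 36 147466 6333 408
      ((p + 6).choose 6) (Nat.choose_pos (by omega)) (phiK p 6) hΦ (by norm_num) (by omega)
      (by norm_num) (by norm_num) (by norm_num) (by norm_num) (by norm_num)
      (by norm_num [cnull]) (by norm_num [cnull]) (Or.inr ⟨by norm_num, by norm_num⟩) (Or.inr (Or.inr (by norm_num))) (Or.inr rfl) (by norm_num) (by norm_num) (by norm_num)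
      ((S1.ncard_triangles_le_of_nullity_sharp M hC1 hC2 (by omega) hd).trans (by norm_num))
      ((ncard_fourCircuits_le_avgChain14 30 M hfree hd).trans (by decide))
      ((S1.ncard_fiveCircuits_le_avgChain5c 30 M hfree hd).trans (by decide))
      (Or.inl (tail_six_heavy_sq25DN_30 p hp)) hR hn hfree (level_six_poly_heavy_sq25DN_30 p hp)
  · exact c025_core_six_heavy_cell_sq27di M p 31 23 1 1 37 0 1 1211 1000 37 171250 7124 437
      ((p + 6).choose 6) (Nat.choose_pos (by omega)) (phiK p 6) hΦ (by norm_num) (by omega)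
      (by norm_num) (by norm_num) (by norm_num) (by norm_num) (by norm_num)
      (by norm_num [cnull]) (by norm_num [cnull]) (Or.inr ⟨by norm_num, by norm_num⟩) (Or.inr (Or.inr (by norm_num))) (Or.inr rfl) (by norm_num) (by norm_num) (by norm_num)
      ((S1.ncard_triangles_le_of_nullity_sharp M hC1 hC2 (by omega) hd).trans (by norm_num))
      ((ncard_fourCircuits_le_avgChain14 31 M hfree hd).trans (by decide))
      ((S1.ncard_fiveCircuits_le_avgChain5c 31 M hfree hd).trans (by decide))
      (Or.inl (tail_six_heavy_sq25DN_31 p hp)) hR hn hfree (level_six_poly_heavy_sq25DN_31 p hp)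
end ThmN

end PercRepro
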